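import Literature.MathematicalPhysics.QuantumFieldTheory.Balaban1983to89.B9Eq349ConjugatedDPCircle
import Literature.MathematicalPhysics.QuantumFieldTheory.Balaban1983to89.B9Eq365QGGQLowerVariationalWindow
import Literature.MathematicalPhysics.QuantumFieldTheory.Balaban1983to89.B9Thm311SitePrimeFormCoerciveCanonical
import Literature.MathematicalPhysics.QuantumFieldTheory.Balaban1983to89.B9Thm311DeltaPrimeA

/-!
# `Balaban1983to89.B9Eq349ConjugatedDPCircleClosed` — T. Bałaban, *Propagators for lattice gauge theories in a background field*, Commun. Math.
# Phys. **99** (1985) 389–434 [Balaban1985BackgroundPropagators] (3.49) p. 399 with Thm 3.11 p. 416, (3.24)–(3.25) p. 394, (3.19) p. 393, (3.101) p. 414: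
# **THE CIRCLE LETTER OF THE CONJUGATED `D P(U)` WITH ITS THREE OPERATOR LETTERS DISCHARGED ON THE DIAGONAL `Lη = 1`** — the site coercivity `γ` of
# `Δ′_{a′}(U)` (from `B9Thm311SitePrimeFormCoerciveCanonical.strong_site_coercive_canonical`), the bound `‖Q̃′(U)‖ ≤ M` (from `norm_Qtilde_flat_le` +
# `norm_Qtilde_sub_flat_le`), the Gram certificate `κ₁` of `Q̃′G′(U)²Q̃′†` (from ne9-leaf-01's `B9Eq365QGGQLowerVariationalWindow.qggq_coercive_window`) and
# the positivity `hpos′` of `Δ′_{a′}(U)` (from `B9Thm311DeltaPrimeA.laplacePrimeA_pos_of_hRS`) become SCALAR conditions on the letters `γ, M, κ₁` against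
# closed constants in `(d, L, a′, M_φ, M_φ′, ‖η⁻¹‖ε_U)` — route R2′ STEP B8′ S-P5(b) → row L9, the porter's composition, part 5

statement-level skeleton of published theorems with citation tags; proofs where landed; nothing here is a claim about the Yang–Mills mass gap

CITATION HEADER (lean-in-tree rule).  Audit cell `pub-balaban`, sub-cell `t4`, BINDER row NE9; filed by NE9 formalisation-swarm leaf prover 06
(`b2b-balaban-t4-ne9-formalise-leaf-06`, gen 67) as the LETTERS' DISCHARGE of its own part 4 `B9Eq349ConjugatedDPCircle.norm_conjFamily_le_of_circle`,
BY NAME from: the cell's B7′ ∕ Thm 3.11 canonical site-coercivity file `B9Thm311SitePrimeFormCoerciveCanonical` (OWNER t4-ne9-p1's (SC) programme with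
ne9-leaf-04's block Poincaré), ne9-leaf-01's (S3c) windowed Gram certificate `B9Eq365QGGQLowerVariationalWindow` (gen 78), and `B9Thm311DeltaPrimeA`
(positivity of `Δ′_{a′}(U)`); CREDIT: every constant below is theirs; this file substitutes («every OPERATOR letter inhabited; the remaining hypotheses
are scalar windows»).  Source READ in the held text [Balaban1985BackgroundPropagators]: p. 399 (3.49), p. 416 Thm 3.11 *«the operators Δ′_a(U), …,
Q′G′(U)²Q′*(U) … are positive, uniformly bounded from below»*, p. 394 (3.24)–(3.25) — as quoted in parts 2∕3.  NOTHING of print's estimate is asserted.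

WHAT IS PROVED (sorry-free; proof lane — no `def`; [folklore] substitution BY NAME).  Setting: part 4's, ON THE DIAGONAL `η·L = 1` with canonical weights
`c₁ = L^d c₀` and `a′ > 0`; `ε_R := 2M_φM_φ′ε_U` the transporter letter (`B9Eq384RemainderLetters.norm_adTransportW_sub_le`), `P := (1 + ε_R)^{d(L−1)}`.
* §1 `norm_Qtilde_le_of_window` — `‖Q̃′(U)λ‖ ≤ P·‖λ‖` (flat count `√(c₁∕(c₀L^d)) = 1` + deviation `(P − 1)`); `coercive_of_canonical_diagonal` — for
  `γ ≤ c_Δ := 1∕(2 + 2∕a′) − (√d‖η⁻¹‖ε_R + (√d‖η⁻¹‖ε_R)² + a′(P − 1)(2 + (P − 1)))`, `0 < γ`: `γ‖f‖² ≤ ‖D_Uf‖² + a′‖Q̃′(U)f‖²` (Thm 3.11 canonical at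
  `Lη = 1` + `re_inner_laplacePrimeA`); `qggq_of_window` — for `κ₁ ≤ κ_U` (ne9-leaf-01's windowed constant, verbatim) the Gram certificate in part 3's shape;
  `kappaU_pos` — `0 < κ_U` for `3 ≤ L`, `0 < a′` (the window `0 < κ₁ ≤ κ_U` is inhabited by `κ₁ := κ_U`; its size is the route's open number, not addressed).
* §2 **`norm_conjFamily_le_of_circle_closed`** — part 4's circle letter with `coercive`, `hκ`, `hMQ`, `hpos′` REPLACED by the scalar conditions
  `γ ≤ c_Δ`, `P ≤ M`, `κ₁ ≤ κ_U` and the averaging window `(P − 1)(L²∕4)^d ≤ ((L−1)(L−2)∕6)^d∕2`; conclusion byte-identical to part 4's.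
* §3 **`norm_comm_comm_DP_le_of_circle_closed`** — the same substitution in part 4's double-commutator read-out (row L9's letter for ONE cut-off):
  NO operator-level hypothesis remains except the structure (`φ`, `U ∈ U1`, `‖U − 1‖ ≤ ε_U`, `hRS`, plaquettes `δ`) and the cut-off data.
* §4 **`norm_DP_le_closed`** — row L8's size letter at `κ = 0`: `‖D_U(x − R(U)x)‖ ≤ 2(C_Ψ⁰ + √a′·P)‖x‖`, `C_Ψ⁰ = √d‖η⁻¹‖(M_φM_φ′)³(27∕4)^d(4∕L + 2(d−1)(L−1)δ)`
  (part 3 with all six multipliers `LinearMap.id`, `β = 0`, cut-offs `0`; the same scalar windows `γ ≤ c_Δ`, `κ₁ ≤ κ_U`).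
* §5 **`exists_uniform_circle_bound`** — §2 with the quantifiers in the order row L9 consumes: `∃ C ≥ 0` BEFORE the background `U` (in the window), the
  cut-off `χ` (with the stated increments) and its multipliers, and `κ` on the circle — the bound is UNIFORM in `U` and `χ` («level-free iff `κ₁` is»).
HONEST SCOPE.  Substitution only; the remaining hypotheses are SCALAR windows in `γ, κ₁, M, β, r, ε_U, δ, ω`; no number is evaluated, no window beyond
`0 < κ_U` is shown non-empty (the limits `β → 0`, `c_Δ → 1∕(2+2∕a′)`, `κ_U → κ(1)` as `r, ε_U → 0` are the consumer's); diagonal `Lη = 1` only.  ONE sub-step of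
ONE route step, NOT NE9 (cell pub-balaban: NE9 NOT PRINTED ∕ NOT PROVED; «NE9 ⇐ the named binders»; spine PROVED 0∕9; rung (B)+1 on a finite T⁴ — NOT infinite
volume, NOT mass gap, NOT Clay; HONEST DEPENDENCY: continuum YM on T⁴ ⇐ BetaPertH ∧ nine spine estimates (0/9 proved); BetaPertH ⇐ (D1) ∧ (D4) ∧ CAP+tail;
G-an2-4 gates asym, D1 and NE2/3/4).  NEW file; nothing modified.  Net new unproved facts: 0.
-/

noncomputable section

set_option autoImplicit false

open scoped InnerProductSpace ComplexConjugate
open NormedSpace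

namespace Literature.MathematicalPhysics.QuantumFieldTheory.Balaban1983to89.B9Eq349ConjugatedDPCircleClosed

open B4Sect5Torus (TSite)
open B9SectCLatticeCarrier (Bond bpos btgt)
open B9Eq311L2Pairing (WL2)
open B9Eq319QprimeTorus (fineP blockCoord)
open B11Eq103H1Complex (SiteL2K BondL2K covDerivL2K)
open B7Prop1Explicit (U1)
open B9Eq310HessianOperator (adTransportW)
open B9Eq310DeltaPrime (plaqHolU)
open B9Eq326OperatorAssembly (QprimeW RofU)
open B9Eq3119DeltaPiCarrier (laplacePrimeA GpOfU)
open B9Eq384RemainderLetters (norm_adTransportW_sub_le)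
open B9Thm311SitePrimeFormCoerciveCanonical (norm_Qtilde_sub_flat_le norm_Qtilde_flat_le strong_site_coercive_canonical)
open B9Thm311DeltaPrimeA (re_inner_laplacePrimeA laplacePrimeA_pos_of_hRS)
open B9Eq365QGGQLowerVariationalWindow (qggq_coercive_window)
open B9Eq349ConjugatedDPChainSection (norm_conjDP_one_sub_RofU_le_section)
open B9Eq349ConjugatedDPCircle (norm_conjFamily_le_of_circle norm_comm_comm_DP_le_of_circle)

variable {d : ℕ} {L : ℕ} [NeZero L] {m : Fin d → ℕ} [∀ i, NeZero (fineP L m i)] {𝔸 : Type*} [NormedRing 𝔸] [NormedAlgebra ℂ 𝔸] [NormOneClass 𝔸]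
  {W : Type*} [NormedAddCommGroup W] [InnerProductSpace ℂ W] [FiniteDimensional ℂ W] {φ : W ≃ₗ[ℂ] 𝔸} {Mφ Mφ' : ℝ}
  (hφ : ∀ w, ‖φ w‖ ≤ Mφ * ‖w‖) (hφ' : ∀ X, ‖φ.symm X‖ ≤ Mφ' * ‖X‖) (hMφ : 0 ≤ Mφ) (hMφ' : 0 ≤ Mφ')
  {c₀ : ℝ} [Fact (0 < c₀)] {η : ℝ} (hη : 0 < η) {U : Bond d (fineP L m) → 𝔸ˣ} (hU : ∀ b, U b ∈ U1 𝔸) {εU : ℝ} (hεU : 0 ≤ εU)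
  (hUε : ∀ b, ‖(U b : 𝔸) - 1‖ ≤ εU) {c₁ : ℝ} [Fact (0 < c₁)] (hc : c₁ = (L : ℝ) ^ d * c₀) {a' : ℝ} (ha' : 0 < a')
  (hRS : ∀ (b : Bond d (fineP L m)) (v u : W), ⟪adTransportW φ U b v, u⟫_ℂ = ⟪v, adTransportW φ (fun b => (U b)⁻¹) b u⟫_ℂ)
  (hηL : η * L = 1)
  -- the cut-offs: increments, and the two pointwise multipliers on fine sites and on bonds (sampled at `b₋`)
  {ℓ ℓ' : ℝ} (hℓ : 0 ≤ ℓ) (hℓ' : 0 ≤ ℓ') {χ : TSite d (fineP L m) → ℝ} {χ' : TSite d m → ℝ}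
  (hχ : ∀ b : Bond d (fineP L m), |χ (bpos b) - χ (btgt b)| ≤ ℓ * η)
  (hχ' : ∀ (y : TSite d m), ∀ x ∈ B9Eq319QprimeTorus.blockOf L m y, |χ' y - χ x| ≤ ℓ')
  {MS : SiteL2K ℂ d (fineP L m) c₀ W →L[ℂ] SiteL2K ℂ d (fineP L m) c₀ W}
  (hMS : ∀ (f : SiteL2K ℂ d (fineP L m) c₀ W) (x : TSite d (fineP L m)),
    WL2.equiv ℂ (fun _ : TSite d (fineP L m) => c₀) W (MS f) x = (χ x : ℂ) • WL2.equiv ℂ (fun _ : TSite d (fineP L m) => c₀) W f x)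
  {MB : BondL2K ℂ d (fineP L m) c₀ W →L[ℂ] BondL2K ℂ d (fineP L m) c₀ W}
  (hMB : ∀ (g : BondL2K ℂ d (fineP L m) c₀ W) (b : Bond d (fineP L m)),
    WL2.equiv ℂ (fun _ : Bond d (fineP L m) => c₀) W (MB g) b = (χ (bpos b) : ℂ) • WL2.equiv ℂ (fun _ : Bond d (fineP L m) => c₀) W g b)

/-! ## §1 The three operator letters from their suppliers -/

omit [∀ i, NeZero (fineP L m i)] [FiniteDimensional ℂ W] in
include hφ hφ' hMφ hMφ' hU hεU hUε hc in
/-- **`‖Q̃′(U)λ‖ ≤ (1 + 2M_φM_φ′ε_U)^{d(L−1)}·‖λ‖`** at canonical weights: flat count (`√(c₁∕(c₀L^d)) = 1`) + deviation (`norm_adTransportW_sub_le`). [cite: Balaban1985BackgroundPropagators, (3.19) p.393, (3.35) p.396] -/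
theorem norm_Qtilde_le_of_window (lam : SiteL2K ℂ d (fineP L m) c₀ W) :
    ‖((WL2.linearEquiv ℂ ℂ (fun _ : TSite d m => c₁)).symm.toLinearMap ∘ₗ QprimeW L m φ U (c₀ := c₀)) lam‖ ≤
      (1 + 2 * Mφ * Mφ' * εU) ^ (d * (L - 1)) * ‖lam‖ := by
  have hc₀ : 0 < c₀ := Fact.out
  have hεR : 0 ≤ 2 * Mφ * Mφ' * εU := by positivity
  have hR : ∀ (b : Bond d (fineP L m)) (w : W), ‖adTransportW φ U b w - w‖ ≤ 2 * Mφ * Mφ' * εU * ‖w‖ := fun b w =>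
    norm_adTransportW_sub_le φ hφ hφ' hMφ' U b (hU b) (hUε b) w
  have hL0 : (0 : ℝ) < L := Nat.cast_pos.mpr (NeZero.pos L)
  have hsq : Real.sqrt (c₁ / (c₀ * (L : ℝ) ^ d)) = 1 := by
    rw [hc, show (L : ℝ) ^ d * c₀ / (c₀ * (L : ℝ) ^ d) = 1 from by
      rw [mul_comm]; exact div_self (by positivity), Real.sqrt_one]
  have h1 := norm_Qtilde_flat_le L m φ (c₁ := c₁) lam
  have h2 := norm_Qtilde_sub_flat_le L m φ U (c₁ := c₁) hεR hR lam
  rw [hsq] at h1 h2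
  calc _ ≤ ‖((WL2.linearEquiv ℂ ℂ (fun _ : TSite d m => c₁)).symm.toLinearMap ∘ₗ
            QprimeW L m φ (fun _ : Bond d (fineP L m) => (1 : 𝔸ˣ)) (c₀ := c₀)) lam‖ + ‖_ - _‖ := norm_le_insert' _ _
    _ ≤ 1 * ‖lam‖ + ((1 + 2 * Mφ * Mφ' * εU) ^ (d * (L - 1)) - 1) * 1 * ‖lam‖ := add_le_add h1 h2
    _ = (1 + 2 * Mφ * Mφ' * εU) ^ (d * (L - 1)) * ‖lam‖ := by ring

omit [∀ i, NeZero (fineP L m i)] in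
include hφ hφ' hMφ hMφ' hU hεU hUε hc ha' hRS hηL in
/-- **THE SITE COERCIVITY LETTER `γ` ON THE DIAGONAL**: for `0 < γ ≤ c_Δ(d, L, a′, ‖η⁻¹‖ε_R, P)`, `γ‖f‖² ≤ ‖D_Uf‖² + a′‖Q̃′(U)f‖²` —
`strong_site_coercive_canonical` at `ηL = 1` (so `c₁(ηL)² = c₀L^d` is the canonical weight relation) read through `re_inner_laplacePrimeA`.
[cite: Balaban1985BackgroundPropagators, Thm 3.11 p.416, (3.24) p.394] -/
theorem coercive_of_canonical_diagonal {γ : ℝ} (hγ : 0 < γ)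
    (hγc : γ ≤ 1 / (2 + 2 / a') -
        (Real.sqrt d * (‖((η : ℂ))⁻¹‖ * (2 * Mφ * Mφ' * εU)) + (Real.sqrt d * (‖((η : ℂ))⁻¹‖ * (2 * Mφ * Mφ' * εU))) ^ 2 +
          a' * (((1 + 2 * Mφ * Mφ' * εU) ^ (d * (L - 1)) - 1)) * (2 + ((1 + 2 * Mφ * Mφ' * εU) ^ (d * (L - 1)) - 1))))
    (f : SiteL2K ℂ d (fineP L m) c₀ W) :
    γ * ‖f‖ ^ 2 ≤ ‖(covDerivL2K ℂ c₀ ((η : ℂ))⁻¹ (adTransportW φ U)) f‖ ^ 2 +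
      a' * ‖((WL2.linearEquiv ℂ ℂ (fun _ : TSite d m => c₁)).symm.toLinearMap ∘ₗ QprimeW L m φ U (c₀ := c₀)) f‖ ^ 2 := by
  have hεR : 0 ≤ 2 * Mφ * Mφ' * εU := by positivity
  have hR : ∀ (b : Bond d (fineP L m)) (w : W), ‖adTransportW φ U b w - w‖ ≤ 2 * Mφ * Mφ' * εU * ‖w‖ := fun b w =>
    norm_adTransportW_sub_le φ hφ hφ' hMφ' U b (hU b) (hUε b) w
  have hηL0 : 0 < η * L := by rw [hηL]; exact one_pos
  have hs : c₁ * (η * L) ^ 2 = c₀ * (L : ℝ) ^ d := by rw [hηL, hc]; ring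
  have h := strong_site_coercive_canonical L m φ U (c₁ := c₁) ha' hRS hεR hR hηL0 hηL.le hs f
  rw [hηL] at h
  simp only [inv_one, one_pow, mul_one, one_mul] at h
  rw [← re_inner_laplacePrimeA L m φ η U a' (c₁ := c₁) hRS f]
  have hc0 : 0 ≤ 1 / (2 + 2 / a') -
      (Real.sqrt d * (‖((η : ℂ))⁻¹‖ * (2 * Mφ * Mφ' * εU)) + (Real.sqrt d * (‖((η : ℂ))⁻¹‖ * (2 * Mφ * Mφ' * εU))) ^ 2 +
        a' * (((1 + 2 * Mφ * Mφ' * εU) ^ (d * (L - 1)) - 1)) * (2 + ((1 + 2 * Mφ * Mφ' * εU) ^ (d * (L - 1)) - 1))) := hγ.le.trans hγc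
  have hD0 : 0 ≤ ‖covDerivL2K ℂ c₀ ((η : ℂ))⁻¹ (adTransportW φ (fun _ : Bond d (fineP L m) => (1 : 𝔸ˣ))) f‖ ^ 2 := sq_nonneg _
  calc γ * ‖f‖ ^ 2 ≤ (1 / (2 + 2 / a') -
        (Real.sqrt d * (‖((η : ℂ))⁻¹‖ * (2 * Mφ * Mφ' * εU)) + (Real.sqrt d * (‖((η : ℂ))⁻¹‖ * (2 * Mφ * Mφ' * εU))) ^ 2 +
          a' * (((1 + 2 * Mφ * Mφ' * εU) ^ (d * (L - 1)) - 1)) * (2 + ((1 + 2 * Mφ * Mφ' * εU) ^ (d * (L - 1)) - 1)))) *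
        (‖covDerivL2K ℂ c₀ ((η : ℂ))⁻¹ (adTransportW φ (fun _ : Bond d (fineP L m) => (1 : 𝔸ˣ))) f‖ ^ 2 + ‖f‖ ^ 2) := by
        nlinarith [mul_nonneg hc0 hD0, sq_nonneg ‖f‖]
    _ ≤ _ := h

omit [∀ i, NeZero (fineP L m i)] [NormOneClass 𝔸] in
include ha' hRS in
/-- `Δ′_{a′}(U)` is positive definite (`B9Thm311DeltaPrimeA.laplacePrimeA_pos_of_hRS`) — the `hpos′` slot of `GpOfU`. [cite: Balaban1985BackgroundPropagators, Thm 3.11 p.416] -/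
theorem laplacePrimeA_pos (hη0 : η ≠ 0) (x : SiteL2K ℂ d (fineP L m) c₀ W) (hx : x ≠ 0) :
    0 < RCLike.re ⟪x, laplacePrimeA L m φ η U a' (c₁ := c₁) x⟫_ℂ :=
  laplacePrimeA_pos_of_hRS L m φ η U a' hη0 ha' hRS x hx

include hφ hφ' hMφ hMφ' hU hεU hUε ha' hRS in
/-- **THE GRAM LETTER `κ₁` FROM ne9-leaf-01's WINDOWED CERTIFICATE**: for `κ₁ ≤ κ_U` (the constant of `B9Eq365QGGQLowerVariationalWindow.qggq_coercive_window`,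
verbatim) and inside its averaging window, `κ₁‖ψ‖² ≤ re⟪ψ, Q̃′G′(U)²Q̃′†ψ⟫` — part 3's `hκ` shape. [cite: Balaban1985BackgroundPropagators, Thm 3.11 p.416, (3.25) p.394] -/
theorem qggq_of_window (hL : 3 ≤ L)
    (hpos' : ∀ x : SiteL2K ℂ d (fineP L m) c₀ W, x ≠ 0 → 0 < RCLike.re ⟪x, laplacePrimeA L m φ η U a' (c₁ := c₁) x⟫_ℂ)
    (hwinU : ((1 + 2 * Mφ * Mφ' * εU) ^ (d * (L - 1)) - 1) * ((L : ℝ) ^ 2 / 4) ^ d ≤ (((L : ℝ) - 1) * ((L : ℝ) - 2) / 6) ^ d / 2)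
    {κ₁ : ℝ} (hκU : κ₁ ≤ ((((((L : ℝ) - 1) * ((L : ℝ) - 2) / 6) ^ d / 2) ^ 2 /
          (2 * (‖((η : ℂ))⁻¹‖ ^ 2 * ((L : ℝ) * ((L : ℝ) ^ 2 / 4) ^ (d - 1)) ^ 2 * (d : ℝ) * (c₀ * (L : ℝ) ^ d / c₁)) +
            2 * (‖((η : ℂ))⁻¹‖ ^ 2 * (2 * Mφ * Mφ' * εU) ^ 2 * (d : ℝ) * (((L : ℝ) ^ 2 / 4) ^ d) ^ 2 * (c₀ * (L : ℝ) ^ d / c₁)) +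
            a' * ((((L : ℝ) - 1) * ((L : ℝ) - 2) / 6) ^ d + (((1 + 2 * Mφ * Mφ' * εU) ^ (d * (L - 1)) - 1) * ((L : ℝ) ^ 2 / 4) ^ d)) ^ 2)) ^ 2 *
        (c₀ * (L : ℝ) ^ d / c₁) / (1 + (((1 + 2 * Mφ * Mφ' * εU) ^ (d * (L - 1)) - 1))) ^ 2))
    (ψ : SiteL2K ℂ d m c₁ W) :
    κ₁ * ‖ψ‖ ^ 2 ≤ RCLike.re ⟪ψ,
      (((WL2.linearEquiv ℂ ℂ (fun _ : TSite d m => c₁)).symm.toLinearMap ∘ₗ QprimeW L m φ U (c₀ := c₀)) ∘ₗ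
        GpOfU L m φ η U a' (c₁ := c₁) hpos' ∘ₗ GpOfU L m φ η U a' (c₁ := c₁) hpos' ∘ₗ
        LinearMap.adjoint ((WL2.linearEquiv ℂ ℂ (fun _ : TSite d m => c₁)).symm.toLinearMap ∘ₗ QprimeW L m φ U (c₀ := c₀))) ψ⟫_ℂ :=
  (mul_le_mul_of_nonneg_right hκU (sq_nonneg _)).trans
    (qggq_coercive_window L m φ c₀ η c₁ hL ha' hMφ hMφ' hφ hφ' U hU hεU hUε hRS hpos' hwinU ψ)

omit [NeZero L] [∀ i, NeZero (fineP L m i)] in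
include hMφ hMφ' hεU ha' in
/-- **`0 < κ_U`**: ne9-leaf-01's windowed Gram constant is POSITIVE for `3 ≤ L`, `0 < a′` (so the scalar window `0 < κ₁ ≤ κ_U` of §2–§4 is inhabited by
`κ₁ := κ_U`; its SIZE is the route's open number «KAPPA1», not addressed here). [cite: Balaban1985BackgroundPropagators, Thm 3.11 p.416, (3.25) p.394] -/
theorem kappaU_pos (hL : 3 ≤ L) : 0 < ((((((L : ℝ) - 1) * ((L : ℝ) - 2) / 6) ^ d / 2) ^ 2 /
          (2 * (‖((η : ℂ))⁻¹‖ ^ 2 * ((L : ℝ) * ((L : ℝ) ^ 2 / 4) ^ (d - 1)) ^ 2 * (d : ℝ) * (c₀ * (L : ℝ) ^ d / c₁)) +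
            2 * (‖((η : ℂ))⁻¹‖ ^ 2 * (2 * Mφ * Mφ' * εU) ^ 2 * (d : ℝ) * (((L : ℝ) ^ 2 / 4) ^ d) ^ 2 * (c₀ * (L : ℝ) ^ d / c₁)) +
            a' * ((((L : ℝ) - 1) * ((L : ℝ) - 2) / 6) ^ d + (((1 + 2 * Mφ * Mφ' * εU) ^ (d * (L - 1)) - 1) * ((L : ℝ) ^ 2 / 4) ^ d)) ^ 2)) ^ 2 *
        (c₀ * (L : ℝ) ^ d / c₁) / (1 + (((1 + 2 * Mφ * Mφ' * εU) ^ (d * (L - 1)) - 1))) ^ 2) := by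
  have hc₀ : 0 < c₀ := Fact.out
  have hc₁ : 0 < c₁ := Fact.out
  have hL3 : (3 : ℝ) ≤ L := by exact_mod_cast hL
  set b0 : ℝ := ((L : ℝ) - 1) * ((L : ℝ) - 2) / 6 with hb0
  have hb0pos : 0 < b0 := by rw [hb0]; nlinarith
  set ρ' : ℝ := (1 + 2 * Mφ * Mφ' * εU) ^ (d * (L - 1)) - 1 with hρ'
  have hρ'0 : 0 ≤ ρ' := by
    rw [hρ']; exact sub_nonneg.2 (one_le_pow₀ (by nlinarith [mul_nonneg (mul_nonneg hMφ hMφ') hεU]))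
  positivity

/-! ## §2 THE CIRCLE LETTER WITH THE OPERATOR LETTERS DISCHARGED -/

include hφ hφ' hMφ hMφ' hη hU hεU hUε hc ha' hRS hηL hℓ hℓ' hχ hχ' hMS hMB in
/-- **THE CONJUGATED `D P(U)` BOUND ON THE CIRCLE `‖κ‖ = r`, OPERATOR LETTERS DISCHARGED (diagonal `Lη = 1`)**: part 4's
`norm_conjFamily_le_of_circle` with `coercive` ← `coercive_of_canonical_diagonal` (`γ ≤ c_Δ`), `hMQ` ← `norm_Qtilde_le_of_window` (`P ≤ M`),
`hκ` ← `qggq_of_window` (`κ₁ ≤ κ_U`, averaging window), `hpos′` ← `laplacePrimeA_pos`; conclusion unchanged. [cite: Balaban1985BackgroundPropagators, (3.49) p.399, Thm 3.11 p.416, (3.101) p.414] -/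
theorem norm_conjFamily_le_of_circle_closed {γ κ₁ M β r : ℝ} (hγ : 0 < γ) (hγ1 : γ ≤ 1) (hκ₁ : 0 < κ₁) (hβ : 0 ≤ β) (hβ1 : β ≤ 1)
    (hγc : γ ≤ 1 / (2 + 2 / a') -
        (Real.sqrt d * (‖((η : ℂ))⁻¹‖ * (2 * Mφ * Mφ' * εU)) + (Real.sqrt d * (‖((η : ℂ))⁻¹‖ * (2 * Mφ * Mφ' * εU))) ^ 2 +
          a' * (((1 + 2 * Mφ * Mφ' * εU) ^ (d * (L - 1)) - 1)) * (2 + ((1 + 2 * Mφ * Mφ' * εU) ^ (d * (L - 1)) - 1))))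
    (hMU : (1 + 2 * Mφ * Mφ' * εU) ^ (d * (L - 1)) ≤ M)
    (hwinU : ((1 + 2 * Mφ * Mφ' * εU) ^ (d * (L - 1)) - 1) * ((L : ℝ) ^ 2 / 4) ^ d ≤ (((L : ℝ) - 1) * ((L : ℝ) - 2) / 6) ^ d / 2)
    (hκU : κ₁ ≤ ((((((L : ℝ) - 1) * ((L : ℝ) - 2) / 6) ^ d / 2) ^ 2 /
          (2 * (‖((η : ℂ))⁻¹‖ ^ 2 * ((L : ℝ) * ((L : ℝ) ^ 2 / 4) ^ (d - 1)) ^ 2 * (d : ℝ) * (c₀ * (L : ℝ) ^ d / c₁)) +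
            2 * (‖((η : ℂ))⁻¹‖ ^ 2 * (2 * Mφ * Mφ' * εU) ^ 2 * (d : ℝ) * (((L : ℝ) ^ 2 / 4) ^ d) ^ 2 * (c₀ * (L : ℝ) ^ d / c₁)) +
            a' * ((((L : ℝ) - 1) * ((L : ℝ) - 2) / 6) ^ d + (((1 + 2 * Mφ * Mφ' * εU) ^ (d * (L - 1)) - 1) * ((L : ℝ) ^ 2 / 4) ^ d)) ^ 2)) ^ 2 *
        (c₀ * (L : ℝ) ^ d / c₁) / (1 + (((1 + 2 * Mφ * Mφ' * εU) ^ (d * (L - 1)) - 1))) ^ 2))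
    (hwin : r * ℓ * η ≤ 1) (hwin' : r * ℓ' ≤ 1)
    (hβD : 2 * r * ℓ * (Mφ * Mφ') * Real.sqrt d ≤ β) (hβQ : 2 * r * ℓ' * (1 + 2 * Mφ * Mφ' * εU) ^ (d * (L - 1)) ≤ β)
    (small : 3 * (1 + a') * β ^ 2 ≤ γ / 4) (hwinκ : 12 * (β * (4 / γ + M * ((4 / γ) ^ 2 * (3 + a' * (2 * M + 1))))) ≤ Real.sqrt κ₁)
    (hd : 1 ≤ d) (hL : 3 ≤ L) (hm : ∀ i, 2 ≤ m i) {δ ω : ℝ} (hδ0 : 0 ≤ δ) (hδ : ∀ p : B9SectCLatticeCarrier.Plaq d (fineP L m), ‖(plaqHolU U p : 𝔸) - 1‖ ≤ δ)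
    (hω : ∀ (b : Bond d (fineP L m)) (x : TSite d (fineP L m)), blockCoord L m x = blockCoord L m (bpos b) → |χ (bpos b) - χ x| ≤ ω)
    (κ : ℂ) (hκr : ‖κ‖ = r) :
    ‖exp (κ • MB) ∘L LinearMap.toContinuousLinearMap
        (covDerivL2K ℂ c₀ ((η : ℂ))⁻¹ (adTransportW φ U) ∘ₗ (LinearMap.id - RofU L m φ η U (c₀ := c₀))) ∘L exp (κ • (-MS))‖ ≤
      2 * (Real.sqrt d * (‖((η : ℂ))⁻¹‖ * (Mφ * Mφ') ^ 3 * (((27 : ℝ) / 4) ^ d * (4 / (L : ℝ) + 2 * ((((d : ℝ) - 1) * ((L : ℝ) - 1)) * δ))) *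
          Real.exp (r * ω)) + 3 * β +
        Real.sqrt (a' * (M + β) ^ 2 + Real.sqrt d * (‖((η : ℂ))⁻¹‖ * (Mφ * Mφ') ^ 3 * (((27 : ℝ) / 4) ^ d *
          (4 / (L : ℝ) + 2 * ((((d : ℝ) - 1) * ((L : ℝ) - 1)) * δ))) * Real.exp (r * ω)) * β + (β ^ 2 + a' * (2 * M * β + β ^ 2)))) := by
  have hpos' : ∀ x : SiteL2K ℂ d (fineP L m) c₀ W, x ≠ 0 → 0 < RCLike.re ⟪x, laplacePrimeA L m φ η U a' (c₁ := c₁) x⟫_ℂ :=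
    laplacePrimeA_pos ha' hRS hη.ne'
  have hM : 0 ≤ M := le_trans (pow_nonneg (by positivity) _) hMU
  have hMQ : ∀ s : SiteL2K ℂ d (fineP L m) c₀ W,
      ‖((WL2.linearEquiv ℂ ℂ (fun _ : TSite d m => c₁)).symm.toLinearMap ∘ₗ QprimeW L m φ U (c₀ := c₀)) s‖ ≤ M * ‖s‖ := fun s =>
    (norm_Qtilde_le_of_window hφ hφ' hMφ hMφ' hU hεU hUε hc s).trans (mul_le_mul_of_nonneg_right hMU (norm_nonneg _))
  exact norm_conjFamily_le_of_circle hφ hφ' hMφ hMφ' hη hU hεU hUε hc ha'.le hRS hpos' hℓ hℓ' hχ hχ' hMS hMB hγ hγ1 hκ₁ hM hβ hβ1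
    (coercive_of_canonical_diagonal hφ hφ' hMφ hMφ' hU hεU hUε hc ha' hRS hηL hγ hγc)
    (qggq_of_window hφ hφ' hMφ hMφ' hU hεU hUε ha' hRS hL hpos' hwinU hκU) hMQ hwin hwin' hβD hβQ small hwinκ hd hL hm hδ0 hδ hω κ hκr

/-! ## §3 Row L9's double-commutator letter with the operator letters discharged -/

include hφ hφ' hMφ hMφ' hη hU hεU hUε hc ha' hRS hηL hℓ hℓ' hχ hχ' hMS hMB in
/-- **`‖M_B ∘ [M,T] − [M,T] ∘ M_S‖ ≤ 2C(r)∕r²`, `T = D_U ∘ (1 − R(U))`, OPERATOR LETTERS DISCHARGED (diagonal `Lη = 1`)** — part 4's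
`norm_comm_comm_DP_le_of_circle` after the substitutions of §2. [cite: Balaban1985BackgroundPropagators, (3.101) p.414, (3.104) p.414, (3.49) p.399, Thm 3.11 p.416] -/
theorem norm_comm_comm_DP_le_of_circle_closed {γ κ₁ M β r : ℝ} (hγ : 0 < γ) (hγ1 : γ ≤ 1) (hκ₁ : 0 < κ₁) (hβ : 0 ≤ β) (hβ1 : β ≤ 1)
    (hr : 0 < r)
    (hγc : γ ≤ 1 / (2 + 2 / a') -
        (Real.sqrt d * (‖((η : ℂ))⁻¹‖ * (2 * Mφ * Mφ' * εU)) + (Real.sqrt d * (‖((η : ℂ))⁻¹‖ * (2 * Mφ * Mφ' * εU))) ^ 2 +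
          a' * (((1 + 2 * Mφ * Mφ' * εU) ^ (d * (L - 1)) - 1)) * (2 + ((1 + 2 * Mφ * Mφ' * εU) ^ (d * (L - 1)) - 1))))
    (hMU : (1 + 2 * Mφ * Mφ' * εU) ^ (d * (L - 1)) ≤ M)
    (hwinU : ((1 + 2 * Mφ * Mφ' * εU) ^ (d * (L - 1)) - 1) * ((L : ℝ) ^ 2 / 4) ^ d ≤ (((L : ℝ) - 1) * ((L : ℝ) - 2) / 6) ^ d / 2)
    (hκU : κ₁ ≤ ((((((L : ℝ) - 1) * ((L : ℝ) - 2) / 6) ^ d / 2) ^ 2 /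
          (2 * (‖((η : ℂ))⁻¹‖ ^ 2 * ((L : ℝ) * ((L : ℝ) ^ 2 / 4) ^ (d - 1)) ^ 2 * (d : ℝ) * (c₀ * (L : ℝ) ^ d / c₁)) +
            2 * (‖((η : ℂ))⁻¹‖ ^ 2 * (2 * Mφ * Mφ' * εU) ^ 2 * (d : ℝ) * (((L : ℝ) ^ 2 / 4) ^ d) ^ 2 * (c₀ * (L : ℝ) ^ d / c₁)) +
            a' * ((((L : ℝ) - 1) * ((L : ℝ) - 2) / 6) ^ d + (((1 + 2 * Mφ * Mφ' * εU) ^ (d * (L - 1)) - 1) * ((L : ℝ) ^ 2 / 4) ^ d)) ^ 2)) ^ 2 *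
        (c₀ * (L : ℝ) ^ d / c₁) / (1 + (((1 + 2 * Mφ * Mφ' * εU) ^ (d * (L - 1)) - 1))) ^ 2))
    (hwin : r * ℓ * η ≤ 1) (hwin' : r * ℓ' ≤ 1)
    (hβD : 2 * r * ℓ * (Mφ * Mφ') * Real.sqrt d ≤ β) (hβQ : 2 * r * ℓ' * (1 + 2 * Mφ * Mφ' * εU) ^ (d * (L - 1)) ≤ β)
    (small : 3 * (1 + a') * β ^ 2 ≤ γ / 4) (hwinκ : 12 * (β * (4 / γ + M * ((4 / γ) ^ 2 * (3 + a' * (2 * M + 1))))) ≤ Real.sqrt κ₁)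
    (hd : 1 ≤ d) (hL : 3 ≤ L) (hm : ∀ i, 2 ≤ m i) {δ ω : ℝ} (hδ0 : 0 ≤ δ) (hδ : ∀ p : B9SectCLatticeCarrier.Plaq d (fineP L m), ‖(plaqHolU U p : 𝔸) - 1‖ ≤ δ)
    (hω : ∀ (b : Bond d (fineP L m)) (x : TSite d (fineP L m)), blockCoord L m x = blockCoord L m (bpos b) → |χ (bpos b) - χ x| ≤ ω) :
    ‖MB ∘L (MB ∘L LinearMap.toContinuousLinearMap
            (covDerivL2K ℂ c₀ ((η : ℂ))⁻¹ (adTransportW φ U) ∘ₗ (LinearMap.id - RofU L m φ η U (c₀ := c₀))) -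
          LinearMap.toContinuousLinearMap
            (covDerivL2K ℂ c₀ ((η : ℂ))⁻¹ (adTransportW φ U) ∘ₗ (LinearMap.id - RofU L m φ η U (c₀ := c₀))) ∘L MS) -
        (MB ∘L LinearMap.toContinuousLinearMap
            (covDerivL2K ℂ c₀ ((η : ℂ))⁻¹ (adTransportW φ U) ∘ₗ (LinearMap.id - RofU L m φ η U (c₀ := c₀))) -
          LinearMap.toContinuousLinearMap
            (covDerivL2K ℂ c₀ ((η : ℂ))⁻¹ (adTransportW φ U) ∘ₗ (LinearMap.id - RofU L m φ η U (c₀ := c₀))) ∘L MS) ∘L MS‖ ≤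
      2 * (2 * (Real.sqrt d * (‖((η : ℂ))⁻¹‖ * (Mφ * Mφ') ^ 3 * (((27 : ℝ) / 4) ^ d * (4 / (L : ℝ) + 2 * ((((d : ℝ) - 1) * ((L : ℝ) - 1)) * δ))) *
          Real.exp (r * ω)) + 3 * β +
        Real.sqrt (a' * (M + β) ^ 2 + Real.sqrt d * (‖((η : ℂ))⁻¹‖ * (Mφ * Mφ') ^ 3 * (((27 : ℝ) / 4) ^ d *
          (4 / (L : ℝ) + 2 * ((((d : ℝ) - 1) * ((L : ℝ) - 1)) * δ))) * Real.exp (r * ω)) * β + (β ^ 2 + a' * (2 * M * β + β ^ 2))))) / r ^ 2 := by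
  have hpos' : ∀ x : SiteL2K ℂ d (fineP L m) c₀ W, x ≠ 0 → 0 < RCLike.re ⟪x, laplacePrimeA L m φ η U a' (c₁ := c₁) x⟫_ℂ :=
    laplacePrimeA_pos ha' hRS hη.ne'
  have hM : 0 ≤ M := le_trans (pow_nonneg (by positivity) _) hMU
  have hMQ : ∀ s : SiteL2K ℂ d (fineP L m) c₀ W,
      ‖((WL2.linearEquiv ℂ ℂ (fun _ : TSite d m => c₁)).symm.toLinearMap ∘ₗ QprimeW L m φ U (c₀ := c₀)) s‖ ≤ M * ‖s‖ := fun s =>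
    (norm_Qtilde_le_of_window hφ hφ' hMφ hMφ' hU hεU hUε hc s).trans (mul_le_mul_of_nonneg_right hMU (norm_nonneg _))
  exact norm_comm_comm_DP_le_of_circle hφ hφ' hMφ hMφ' hη hU hεU hUε hc ha'.le hRS hpos' hℓ hℓ' hχ hχ' hMS hMB hγ hγ1 hκ₁ hM hβ hβ1 hr
    (coercive_of_canonical_diagonal hφ hφ' hMφ hMφ' hU hεU hUε hc ha' hRS hηL hγ hγc)
    (qggq_of_window hφ hφ' hMφ hMφ' hU hεU hUε ha' hRS hL hpos' hwinU hκU) hMQ hwin hwin' hβD hβQ small hwinκ hd hL hm hδ0 hδ hω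

/-! ## §4 Row L8's letter `C_W`: the UNconjugated `D_U P(U)` at `κ = 0`, operator letters discharged -/

include hφ hφ' hMφ hMφ' hη hU hεU hUε hc ha' hRS hηL in
/-- **`‖D_U(x − R(U)x)‖ ≤ 2(C_Ψ⁰ + √a′·P)·‖x‖`, `C_Ψ⁰ = √d‖η⁻¹‖(M_φM_φ′)³(27∕4)^d(4∕L + 2(d−1)(L−1)δ)`, `P = (1 + 2M_φM_φ′ε_U)^{d(L−1)}`** — part 3's
`norm_conjDP_one_sub_RofU_le_section` at `κ = 0` (all six multipliers `:= LinearMap.id`, `β = 0`, cut-offs `0`) with `coercive`∕`hκ`∕`hMQ`∕`hpos′` discharged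
as in §2: the instance-ledger row L8's size letter `C_W = ‖(D_UP(U))†‖ = ‖D_UP(U)‖` at the chain, on the diagonal, modulo the scalar windows `γ ≤ c_Δ`,
`κ₁ ≤ κ_U`. [cite: Balaban1985BackgroundPropagators, (3.49) p.399, (3.26) p.395, Thm 3.11 p.416] -/
theorem norm_DP_le_closed {γ κ₁ : ℝ} (hγ : 0 < γ) (hγ1 : γ ≤ 1) (hκ₁ : 0 < κ₁)
    (hγc : γ ≤ 1 / (2 + 2 / a') -
        (Real.sqrt d * (‖((η : ℂ))⁻¹‖ * (2 * Mφ * Mφ' * εU)) + (Real.sqrt d * (‖((η : ℂ))⁻¹‖ * (2 * Mφ * Mφ' * εU))) ^ 2 +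
          a' * (((1 + 2 * Mφ * Mφ' * εU) ^ (d * (L - 1)) - 1)) * (2 + ((1 + 2 * Mφ * Mφ' * εU) ^ (d * (L - 1)) - 1))))
    (hwinU : ((1 + 2 * Mφ * Mφ' * εU) ^ (d * (L - 1)) - 1) * ((L : ℝ) ^ 2 / 4) ^ d ≤ (((L : ℝ) - 1) * ((L : ℝ) - 2) / 6) ^ d / 2)
    (hκU : κ₁ ≤ ((((((L : ℝ) - 1) * ((L : ℝ) - 2) / 6) ^ d / 2) ^ 2 /
          (2 * (‖((η : ℂ))⁻¹‖ ^ 2 * ((L : ℝ) * ((L : ℝ) ^ 2 / 4) ^ (d - 1)) ^ 2 * (d : ℝ) * (c₀ * (L : ℝ) ^ d / c₁)) +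
            2 * (‖((η : ℂ))⁻¹‖ ^ 2 * (2 * Mφ * Mφ' * εU) ^ 2 * (d : ℝ) * (((L : ℝ) ^ 2 / 4) ^ d) ^ 2 * (c₀ * (L : ℝ) ^ d / c₁)) +
            a' * ((((L : ℝ) - 1) * ((L : ℝ) - 2) / 6) ^ d + (((1 + 2 * Mφ * Mφ' * εU) ^ (d * (L - 1)) - 1) * ((L : ℝ) ^ 2 / 4) ^ d)) ^ 2)) ^ 2 *
        (c₀ * (L : ℝ) ^ d / c₁) / (1 + (((1 + 2 * Mφ * Mφ' * εU) ^ (d * (L - 1)) - 1))) ^ 2))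
    (hd : 1 ≤ d) (hL : 3 ≤ L) (hm : ∀ i, 2 ≤ m i) {δ : ℝ} (hδ0 : 0 ≤ δ) (hδ : ∀ p : B9SectCLatticeCarrier.Plaq d (fineP L m), ‖(plaqHolU U p : 𝔸) - 1‖ ≤ δ)
    (x : SiteL2K ℂ d (fineP L m) c₀ W) :
    ‖(covDerivL2K ℂ c₀ ((η : ℂ))⁻¹ (adTransportW φ U)) (x - RofU L m φ η U (c₀ := c₀) x)‖ ≤
      2 * (Real.sqrt d * (‖((η : ℂ))⁻¹‖ * (Mφ * Mφ') ^ 3 * (((27 : ℝ) / 4) ^ d * (4 / (L : ℝ) + 2 * ((((d : ℝ) - 1) * ((L : ℝ) - 1)) * δ)))) +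
        Real.sqrt a' * (1 + 2 * Mφ * Mφ' * εU) ^ (d * (L - 1))) * ‖x‖ := by
  have hpos' : ∀ x : SiteL2K ℂ d (fineP L m) c₀ W, x ≠ 0 → 0 < RCLike.re ⟪x, laplacePrimeA L m φ η U a' (c₁ := c₁) x⟫_ℂ :=
    laplacePrimeA_pos ha' hRS hη.ne'
  have hP0 : 0 ≤ (1 + 2 * Mφ * Mφ' * εU) ^ (d * (L - 1)) := pow_nonneg (by positivity) _
  -- the identity multipliers act as `e^{±0·χ}` for the cut-off `χ = 0`
  have hid : ∀ (f : SiteL2K ℂ d (fineP L m) c₀ W) (y : TSite d (fineP L m)),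
      WL2.equiv ℂ (fun _ : TSite d (fineP L m) => c₀) W ((LinearMap.id : SiteL2K ℂ d (fineP L m) c₀ W →ₗ[ℂ] _) f) y =
        Complex.exp ((0 : ℂ) * (((fun _ : TSite d (fineP L m) => (0 : ℝ)) y : ℝ) : ℂ)) • WL2.equiv ℂ (fun _ : TSite d (fineP L m) => c₀) W f y :=
    fun f y => by simp
  have hid' : ∀ (f : SiteL2K ℂ d (fineP L m) c₀ W) (y : TSite d (fineP L m)),
      WL2.equiv ℂ (fun _ : TSite d (fineP L m) => c₀) W ((LinearMap.id : SiteL2K ℂ d (fineP L m) c₀ W →ₗ[ℂ] _) f) y =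
        Complex.exp (-((0 : ℂ) * (((fun _ : TSite d (fineP L m) => (0 : ℝ)) y : ℝ) : ℂ))) • WL2.equiv ℂ (fun _ : TSite d (fineP L m) => c₀) W f y :=
    fun f y => by simp
  have hidB : ∀ (g : BondL2K ℂ d (fineP L m) c₀ W) (b : Bond d (fineP L m)),
      WL2.equiv ℂ (fun _ : Bond d (fineP L m) => c₀) W ((LinearMap.id : BondL2K ℂ d (fineP L m) c₀ W →ₗ[ℂ] _) g) b =
        Complex.exp ((0 : ℂ) * (((fun _ : TSite d (fineP L m) => (0 : ℝ)) (bpos b) : ℝ) : ℂ)) • WL2.equiv ℂ (fun _ : Bond d (fineP L m) => c₀) W g b :=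
    fun g b => by simp
  have hidB' : ∀ (g : BondL2K ℂ d (fineP L m) c₀ W) (b : Bond d (fineP L m)),
      WL2.equiv ℂ (fun _ : Bond d (fineP L m) => c₀) W ((LinearMap.id : BondL2K ℂ d (fineP L m) c₀ W →ₗ[ℂ] _) g) b =
        Complex.exp (-((0 : ℂ) * (((fun _ : TSite d (fineP L m) => (0 : ℝ)) (bpos b) : ℝ) : ℂ))) • WL2.equiv ℂ (fun _ : Bond d (fineP L m) => c₀) W g b :=
    fun g b => by simp
  have hidG : ∀ (g : SiteL2K ℂ d m c₁ W) (y : TSite d m),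
      WL2.equiv ℂ (fun _ : TSite d m => c₁) W ((LinearMap.id : SiteL2K ℂ d m c₁ W →ₗ[ℂ] _) g) y =
        Complex.exp ((0 : ℂ) * (((fun _ : TSite d m => (0 : ℝ)) y : ℝ) : ℂ)) • WL2.equiv ℂ (fun _ : TSite d m => c₁) W g y :=
    fun g y => by simp
  have hidG' : ∀ (g : SiteL2K ℂ d m c₁ W) (y : TSite d m),
      WL2.equiv ℂ (fun _ : TSite d m => c₁) W ((LinearMap.id : SiteL2K ℂ d m c₁ W →ₗ[ℂ] _) g) y =
        Complex.exp (-((0 : ℂ) * (((fun _ : TSite d m => (0 : ℝ)) y : ℝ) : ℂ))) • WL2.equiv ℂ (fun _ : TSite d m => c₁) W g y :=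
    fun g y => by simp
  have hχ0 : ∀ b : Bond d (fineP L m), |(fun _ : TSite d (fineP L m) => (0 : ℝ)) (bpos b) - (fun _ : TSite d (fineP L m) => (0 : ℝ)) (btgt b)| ≤ 0 * η :=
    fun b => by simp
  have hχ0' : ∀ (y : TSite d m), ∀ z ∈ B9Eq319QprimeTorus.blockOf L m y,
      |(fun _ : TSite d m => (0 : ℝ)) y - (fun _ : TSite d (fineP L m) => (0 : ℝ)) z| ≤ 0 := fun y z _ => by simp
  have hω0 : ∀ (b : Bond d (fineP L m)) (z : TSite d (fineP L m)), blockCoord L m z = blockCoord L m (bpos b) →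
      |(fun _ : TSite d (fineP L m) => (0 : ℝ)) (bpos b) - (fun _ : TSite d (fineP L m) => (0 : ℝ)) z| ≤ 0 := fun b z _ => by simp
  have h := norm_conjDP_one_sub_RofU_le_section hφ hφ' hMφ hMφ' hη hU hεU hUε hc ha'.le hRS hpos' le_rfl le_rfl hχ0 hχ0'
    (by simp) (by simp) hid hid' hidB hidB' hidG hidG' hγ hγ1 hκ₁ hP0 le_rfl zero_le_one
    (coercive_of_canonical_diagonal hφ hφ' hMφ hMφ' hU hεU hUε hc ha' hRS hηL hγ hγc)
    (qggq_of_window hφ hφ' hMφ hMφ' hU hεU hUε ha' hRS hL hpos' hwinU hκU) (norm_Qtilde_le_of_window hφ hφ' hMφ hMφ' hU hεU hUε hc)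
    (by simp) (by simp) (by simp; positivity) (by simp) hd hL hm hδ0 hδ hω0 x
  have hsimp : Real.sqrt (a' * ((1 + 2 * Mφ * Mφ' * εU) ^ (d * (L - 1)) + 0) ^ 2 +
      Real.sqrt d * (‖((η : ℂ))⁻¹‖ * (Mφ * Mφ') ^ 3 * (((27 : ℝ) / 4) ^ d * (4 / (L : ℝ) + 2 * ((((d : ℝ) - 1) * ((L : ℝ) - 1)) * δ))) *
        Real.exp (‖(0 : ℂ)‖ * 0)) * 0 + ((0 : ℝ) ^ 2 + a' * (2 * (1 + 2 * Mφ * Mφ' * εU) ^ (d * (L - 1)) * 0 + (0 : ℝ) ^ 2))) =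
      Real.sqrt a' * (1 + 2 * Mφ * Mφ' * εU) ^ (d * (L - 1)) := by
    rw [show a' * ((1 + 2 * Mφ * Mφ' * εU) ^ (d * (L - 1)) + 0) ^ 2 +
      Real.sqrt d * (‖((η : ℂ))⁻¹‖ * (Mφ * Mφ') ^ 3 * (((27 : ℝ) / 4) ^ d * (4 / (L : ℝ) + 2 * ((((d : ℝ) - 1) * ((L : ℝ) - 1)) * δ))) *
        Real.exp (‖(0 : ℂ)‖ * 0)) * 0 + ((0 : ℝ) ^ 2 + a' * (2 * (1 + 2 * Mφ * Mφ' * εU) ^ (d * (L - 1)) * 0 + (0 : ℝ) ^ 2)) =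
      a' * ((1 + 2 * Mφ * Mφ' * εU) ^ (d * (L - 1))) ^ 2 by ring, Real.sqrt_mul ha'.le, Real.sqrt_sq hP0]
  simp only [LinearMap.comp_apply, LinearMap.id_apply] at h
  rw [hsimp, norm_zero, zero_mul, Real.exp_zero, mul_one, mul_zero, add_zero] at h
  exact h

/-! ## §5 `∃ C` BEFORE the background and the cut-off: the circle letter is UNIFORM in `U` and `χ` -/

include hφ hφ' hMφ hMφ' hη hεU hc ha' hηL in
/-- **UNIFORMITY, `∃`-FIRST**: for fixed structure constants and scalar windows there is ONE `C ≥ 0` such that for EVERY background `U` in the window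
(`U(b) ∈ U1`, `‖U(b) − 1‖ ≤ ε_U`, mutually adjoint transports, plaquettes `≤ δ`) and EVERY cut-off `χ` with the stated increments (and any pointwise
multipliers `M_S`, `M_B` realising it) the dressed `D_UP(U)` is bounded by `C` on the whole circle `‖κ‖ = r` — §2 in the quantifier order row L9 consumes
(`C` depends on `d, L, a′, M_φ, M_φ′, ‖η⁻¹‖, ε_U, δ, ω, β, M, r` only). [cite: Balaban1985BackgroundPropagators, (3.49) p.399, Thm 3.11 p.416, (3.101) p.414] -/
theorem exists_uniform_circle_bound {γ κ₁ M β r : ℝ} (hγ : 0 < γ) (hγ1 : γ ≤ 1) (hκ₁ : 0 < κ₁) (hβ : 0 ≤ β) (hβ1 : β ≤ 1)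
    (hγc : γ ≤ 1 / (2 + 2 / a') -
        (Real.sqrt d * (‖((η : ℂ))⁻¹‖ * (2 * Mφ * Mφ' * εU)) + (Real.sqrt d * (‖((η : ℂ))⁻¹‖ * (2 * Mφ * Mφ' * εU))) ^ 2 +
          a' * (((1 + 2 * Mφ * Mφ' * εU) ^ (d * (L - 1)) - 1)) * (2 + ((1 + 2 * Mφ * Mφ' * εU) ^ (d * (L - 1)) - 1))))
    (hMU : (1 + 2 * Mφ * Mφ' * εU) ^ (d * (L - 1)) ≤ M)
    (hwinU : ((1 + 2 * Mφ * Mφ' * εU) ^ (d * (L - 1)) - 1) * ((L : ℝ) ^ 2 / 4) ^ d ≤ (((L : ℝ) - 1) * ((L : ℝ) - 2) / 6) ^ d / 2)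
    (hκU : κ₁ ≤ ((((((L : ℝ) - 1) * ((L : ℝ) - 2) / 6) ^ d / 2) ^ 2 /
          (2 * (‖((η : ℂ))⁻¹‖ ^ 2 * ((L : ℝ) * ((L : ℝ) ^ 2 / 4) ^ (d - 1)) ^ 2 * (d : ℝ) * (c₀ * (L : ℝ) ^ d / c₁)) +
            2 * (‖((η : ℂ))⁻¹‖ ^ 2 * (2 * Mφ * Mφ' * εU) ^ 2 * (d : ℝ) * (((L : ℝ) ^ 2 / 4) ^ d) ^ 2 * (c₀ * (L : ℝ) ^ d / c₁)) +
            a' * ((((L : ℝ) - 1) * ((L : ℝ) - 2) / 6) ^ d + (((1 + 2 * Mφ * Mφ' * εU) ^ (d * (L - 1)) - 1) * ((L : ℝ) ^ 2 / 4) ^ d)) ^ 2)) ^ 2 *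
        (c₀ * (L : ℝ) ^ d / c₁) / (1 + (((1 + 2 * Mφ * Mφ' * εU) ^ (d * (L - 1)) - 1))) ^ 2))
    {ℓ ℓ' : ℝ} (hℓ : 0 ≤ ℓ) (hℓ' : 0 ≤ ℓ') (hwin : r * ℓ * η ≤ 1) (hwin' : r * ℓ' ≤ 1)
    (hβD : 2 * r * ℓ * (Mφ * Mφ') * Real.sqrt d ≤ β) (hβQ : 2 * r * ℓ' * (1 + 2 * Mφ * Mφ' * εU) ^ (d * (L - 1)) ≤ β)
    (small : 3 * (1 + a') * β ^ 2 ≤ γ / 4) (hwinκ : 12 * (β * (4 / γ + M * ((4 / γ) ^ 2 * (3 + a' * (2 * M + 1))))) ≤ Real.sqrt κ₁)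
    (hd : 1 ≤ d) (hL : 3 ≤ L) (hm : ∀ i, 2 ≤ m i) {δ ω : ℝ} (hδ0 : 0 ≤ δ) :
    ∃ C : ℝ, 0 ≤ C ∧ ∀ (U : Bond d (fineP L m) → 𝔸ˣ) (hU : ∀ b, U b ∈ U1 𝔸) (hUε : ∀ b, ‖(U b : 𝔸) - 1‖ ≤ εU)
      (hRS : ∀ (b : Bond d (fineP L m)) (v u : W), ⟪adTransportW φ U b v, u⟫_ℂ = ⟪v, adTransportW φ (fun b => (U b)⁻¹) b u⟫_ℂ)
      (hδ : ∀ p : B9SectCLatticeCarrier.Plaq d (fineP L m), ‖(plaqHolU U p : 𝔸) - 1‖ ≤ δ)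
      (χ : TSite d (fineP L m) → ℝ) (χ' : TSite d m → ℝ) (hχ : ∀ b : Bond d (fineP L m), |χ (bpos b) - χ (btgt b)| ≤ ℓ * η)
      (hχ' : ∀ (y : TSite d m), ∀ x ∈ B9Eq319QprimeTorus.blockOf L m y, |χ' y - χ x| ≤ ℓ')
      (hω : ∀ (b : Bond d (fineP L m)) (x : TSite d (fineP L m)), blockCoord L m x = blockCoord L m (bpos b) → |χ (bpos b) - χ x| ≤ ω)
      (MS : SiteL2K ℂ d (fineP L m) c₀ W →L[ℂ] SiteL2K ℂ d (fineP L m) c₀ W)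
      (hMS : ∀ (f : SiteL2K ℂ d (fineP L m) c₀ W) (x : TSite d (fineP L m)),
        WL2.equiv ℂ (fun _ : TSite d (fineP L m) => c₀) W (MS f) x = (χ x : ℂ) • WL2.equiv ℂ (fun _ : TSite d (fineP L m) => c₀) W f x)
      (MB : BondL2K ℂ d (fineP L m) c₀ W →L[ℂ] BondL2K ℂ d (fineP L m) c₀ W)
      (hMB : ∀ (g : BondL2K ℂ d (fineP L m) c₀ W) (b : Bond d (fineP L m)),
        WL2.equiv ℂ (fun _ : Bond d (fineP L m) => c₀) W (MB g) b = (χ (bpos b) : ℂ) • WL2.equiv ℂ (fun _ : Bond d (fineP L m) => c₀) W g b)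
      (κ : ℂ) (hκr : ‖κ‖ = r),
      ‖exp (κ • MB) ∘L LinearMap.toContinuousLinearMap
          (covDerivL2K ℂ c₀ ((η : ℂ))⁻¹ (adTransportW φ U) ∘ₗ (LinearMap.id - RofU L m φ η U (c₀ := c₀))) ∘L exp (κ • (-MS))‖ ≤ C := by
  refine ⟨2 * (Real.sqrt d * (‖((η : ℂ))⁻¹‖ * (Mφ * Mφ') ^ 3 * (((27 : ℝ) / 4) ^ d * (4 / (L : ℝ) + 2 * ((((d : ℝ) - 1) * ((L : ℝ) - 1)) * δ))) *
          Real.exp (r * ω)) + 3 * β +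
        Real.sqrt (a' * (M + β) ^ 2 + Real.sqrt d * (‖((η : ℂ))⁻¹‖ * (Mφ * Mφ') ^ 3 * (((27 : ℝ) / 4) ^ d *
          (4 / (L : ℝ) + 2 * ((((d : ℝ) - 1) * ((L : ℝ) - 1)) * δ))) * Real.exp (r * ω)) * β + (β ^ 2 + a' * (2 * M * β + β ^ 2)))), ?_, ?_⟩
  · have hL1 : (1 : ℝ) ≤ L := by exact_mod_cast (show 1 ≤ L by omega)
    have : 0 ≤ (((d : ℝ) - 1) * ((L : ℝ) - 1)) * δ :=
      mul_nonneg (mul_nonneg (by rw [sub_nonneg]; exact_mod_cast hd) (by linarith)) hδ0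
    positivity
  · intro U hU hUε hRS hδ χ χ' hχ hχ' hω MS hMS MB hMB κ hκr
    exact norm_conjFamily_le_of_circle_closed hφ hφ' hMφ hMφ' hη hU hεU hUε hc ha' hRS hηL hℓ hℓ' hχ hχ' hMS hMB hγ hγ1 hκ₁ hβ hβ1 hγc hMU
      hwinU hκU hwin hwin' hβD hβQ small hwinκ hd hL hm hδ0 hδ hω κ hκr

end Literature.MathematicalPhysics.QuantumFieldTheory.Balaban1983to89.B9Eq349ConjugatedDPCircleClosed

end
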